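import Literature.AlgebraicGeometry.GroupSchemes.EtaleIdealEqPointsIdeal
import Literature.AlgebraicGeometry.Motives.AbelianVarietyTorsion
import Mathlib.RingTheory.FinitePresentation
import HarnessLib

/-!
# Closed subschemes of a finite étale scheme over a separably closed field are the subsets of its points: every ideal is the ideal of
# its points, degree = number of points ([Tate1997FiniteFlatGroupSchemes] (3.7); [StacksProject] 00U3)

Topic `Literature/AlgebraicGeometry/GroupSchemes`; namespace `Literature.AlgebraicGeometry.GroupSchemes.EtaleIdealPoints` (continues ★
`EtaleIdealEqPointsIdeal`).  THEOREMS ONLY (no definition, no instance, no notation, no named fact, no `sorry`).  Cell `hodgecm-mathlib` (D-0151),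
programme P6 «MOD» (crux hLiu418 = stmt-HodgeConjecture-24832, `--supports`, count-neutral): generic organ for the D-line `stub_SPEC` road — the
UPSTAIRS dictionary between the carrier `LineOf I y` (subgroups of `Ω`-POINTS of the generic `w`-layer, fork F1 (a) ADM of the cut memo
`MEMO-DLINE-cut.v1.F0P6c-plan-g4`) and the admissible IDEALS of `Γ(𝒢_K)` on which ★ `spI` (`AdmissibleIdealSpecialFibre`) and ★ (E-b4′)
`CanonicalLineAssembly` are stated: over the separably closed `Ω` the generic fibre `𝒢_Ω` is finite ÉTALE, so its closed subschemes ARE the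
subsets of `𝒢(Ω)` and their degrees are point counts (e.g. the `q + 1` lines are `q + 1` distinct admissible ideals — the `htwo` input of ★
`AdmSpecialFibreSurj.exists_admissible_spI_eq_of_ordinary`).  HC_CM is proved only modulo the printed citations until rung 0 closes; this file
is generic and changes no count.

THE PRINT.  [StacksProject] Tag 00U3: an étale algebra over a separably closed field `k` is a finite product of copies of `k`; hence so is each of
its quotients, every ideal of `k^n` is the ideal of functions vanishing on a subset, and `dim_k (k^n ⧸ I_S) = |S|`.  [Tate1997FiniteFlatGroupSchemes]
(3.7): finite étale group schemes over `k̄` «are» their groups of points; closed subgroup schemes ↔ subgroups.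

## Contents
* §1 `etale_quotient_of_etale`: a quotient of an étale algebra over a field is étale (Mathlib `FormallyUnramified.quotient` +
  `FormallyEtale.of_formallyUnramified_of_field`).
* §2 for `G : SchemeOver k` affine, `G → Spec k` étale, `k` separably closed: `algebraEtale_alg`, `etale_specOver_quotient` (every `Spec (Γ(G)⧸I)`
  is étale — so ★ `EtaleIdealEqPointsIdeal` applies to EVERY ideal), **`eq_ker_pi_ptEquiv_points`** (`I =` the ★ points ideal of the points of
  `V(I)`), **`finrank_quotient_eq_natCard_points`** (`dim_k Γ(G)⧸I = #V(I)(k)`), **`eq_iff_forall_le_ker_ptEquiv_iff`** ∕ `le_iff_forall_le_ker_ptEquiv`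
  (ideals are determined, with inclusions reversed, by their points).  With ★ `HopfIdealOfFiniteSubgroupOfPoints.isHopfIdeal_ker_pi` (a finite
  subgroup of points ↦ a Hopf ideal with exactly those points) and ★ `HopfIdealClosedSubgroup` §4 (the points killing a Hopf ideal form a
  subgroup) this is the full dictionary «Hopf ideals of `Γ(G)` ↔ subgroups of `G(k)`».

## References
* [Tate1997FiniteFlatGroupSchemes] J. Tate, *Finite flat group schemes*, in: Modular Forms and Fermat's Last Theorem (1997), (3.7).
* [StacksProject] The Stacks Project, Tag 00U3 (étale algebras over separably closed fields split).
* [GortzWedhorn2020] U. Görtz, T. Wedhorn, *Algebraic Geometry I*, 2nd ed. (2020), Section (4.7).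
-/

set_option autoImplicit false

-- Mathlib's `Over`/`Scheme` APIs are stated across semireducible wrappers (as in the ★ `GroupSchemes/*` files).
set_option backward.isDefEq.respectTransparency false

universe u

open CategoryTheory CategoryTheory.Limits AlgebraicGeometry MonoidalCategory CartesianMonoidalCategory

noncomputable section

namespace Literature.AlgebraicGeometry.GroupSchemes

namespace EtaleIdealPoints

/-! ## §1 Quotients of étale algebras over a field are étale -/

/-- **A quotient of an étale algebra over a field is étale** (unramified passes to quotients; over a field, unramified + essentially of finite
type ⇒ étale, Mathlib `Algebra.FormallyEtale.of_formallyUnramified_of_field`; finite type ⇒ finite presentation over the noetherian `k`).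
Geometrically: every closed subscheme of a finite étale `k`-scheme is finite étale. [cite: StacksProject, Tag 00U3] -/
theorem etale_quotient_of_etale {k A : Type*} [Field k] [CommRing A] [Algebra k A] [Algebra.Etale k A] (I : Ideal A) :
    Algebra.Etale k (A ⧸ I) :=
  haveI : Algebra.FormallyEtale k (A ⧸ I) := Algebra.FormallyEtale.of_formallyUnramified_of_field k (A ⧸ I)
  haveI : Algebra.FinitePresentation k (A ⧸ I) := (Algebra.FinitePresentation.of_finiteType (R := k) (A := A ⧸ I)).mp inferInstance
  ⟨inferInstance, inferInstance⟩

/-! ## §2 Ideals of a finite étale scheme over a separably closed field are determined by their points -/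

section Scheme

open Literature.AlgebraicGeometry.Motives AffineGroupScheme

variable {k : Type u} [Field k] (G : SchemeOver k) [IsAffine G.left]

/-- `Γ(G)` is an étale `k`-algebra when `G → Spec k` is étale and `G` affine (★ `Motives.etale_algebraMapΓ`; the `k`-algebra structure of ★ `Alg G`
IS `algebraMapΓ`). [cite: GortzWedhorn2020, Section (4.7)] -/
theorem algebraEtale_alg [Etale G.hom] : Algebra.Etale k (Alg G) :=
  Motives.etale_algebraMapΓ G.hom

/-- **Every closed subscheme `Spec (Γ(G) ⧸ I)` of a finite étale `G` is étale over `k`** (§1). [cite: StacksProject, Tag 00U3] -/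
theorem etale_specOver_quotient [Etale G.hom] (I : Ideal (Alg G)) : Etale (specOver k (Alg G ⧸ I)).hom := by
  haveI := algebraEtale_alg G
  haveI := etale_quotient_of_etale (k := k) I
  change Etale (Spec.map (CommRingCat.ofHom (algebraMap k (Alg G ⧸ I))))
  rw [HasRingHomProperty.Spec_iff (P := @Etale), CommRingCat.hom_ofHom, RingHom.etale_algebraMap]
  infer_instance

variable [IsSepClosed k] [Etale G.hom]

/-- **AN IDEAL OF A FINITE ÉTALE SCHEME IS THE IDEAL OF ITS POINTS**: for `G` affine étale over a separably closed field and ANY ideal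
`I ⊂ Γ(G)`, `I = ⋂ {ker φ_x : x ∈ G(k), I ≤ ker φ_x}` — the ★ points ideal `ker (ptEquiv x)_x` (`HopfIdealOfFiniteSubgroupOfPoints`) of the family
of points of `V(I)`. [cite: StacksProject, Tag 00U3] [cite: Tate1997FiniteFlatGroupSchemes, (3.7)] -/
theorem eq_ker_pi_ptEquiv_points (I : Ideal (Alg G)) :
    I = RingHom.ker (AlgHom.pi fun x : {x : specOver k k ⟶ G // I ≤ RingHom.ker (ptEquiv G k x).toRingHom} => ptEquiv G k x.1 :
      Alg G →ₐ[k] ({x : specOver k k ⟶ G // I ≤ RingHom.ker (ptEquiv G k x).toRingHom} → k)).toRingHom := by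
  haveI := algebraEtale_alg G
  haveI := etale_quotient_of_etale (k := k) I
  ext a
  rw [RingHom.mem_ker, AlgHom.toRingHom_eq_coe, AlgHom.coe_toRingHom, EtaleIdealPoints.mem_iff_forall_algHom_apply_eq_zero (k := k) I a]
  constructor
  · intro h
    funext x
    rw [AlgHom.pi_apply, Pi.zero_apply]
    exact h _ x.2
  · intro h χ hχ
    have := congr_fun h ⟨(ptEquiv G k).symm χ, by simpa only [Equiv.apply_symm_apply] using hχ⟩
    simpa only [AlgHom.pi_apply, Equiv.apply_symm_apply, Pi.zero_apply] using this

/-- **THE DEGREE OF A CLOSED SUBSCHEME OF A FINITE ÉTALE SCHEME IS ITS NUMBER OF POINTS**: `dim_k (Γ(G) ⧸ I) = #{x ∈ G(k) | I ≤ ker φ_x}`.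
[cite: StacksProject, Tag 00U3] [cite: Tate1997FiniteFlatGroupSchemes, (3.7)] -/
theorem finrank_quotient_eq_natCard_points (I : Ideal (Alg G)) :
    Module.finrank k (Alg G ⧸ I) = Nat.card {x : specOver k k ⟶ G // I ≤ RingHom.ker (ptEquiv G k x).toRingHom} := by
  haveI := algebraEtale_alg G
  haveI := etale_quotient_of_etale (k := k) I
  obtain ⟨χ, hinj, hker, hsurj, hc⟩ := EtaleIdealPoints.exists_injective_algHom_of_etale (k := k) I
  rw [← hc]
  -- `Spec (Γ(G) ⧸ I) ≃ {χ | I ≤ ker χ} ≃ {x | I ≤ ker φ_x}`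
  let f : PrimeSpectrum (Alg G ⧸ I) → {x : specOver k k ⟶ G // I ≤ RingHom.ker (ptEquiv G k x).toRingHom} :=
    fun p => ⟨(ptEquiv G k).symm (χ p), by simpa only [Equiv.apply_symm_apply] using hker p⟩
  refine Nat.card_congr (Equiv.ofBijective f ⟨fun p q hpq => hinj ((ptEquiv G k).symm.injective (congrArg Subtype.val hpq)), fun x => ?_⟩)
  obtain ⟨p, hp⟩ := hsurj (ptEquiv G k x.1) x.2
  exact ⟨p, Subtype.ext (by simp only [f, hp, Equiv.symm_apply_apply])⟩

/-- **IDEALS OF A FINITE ÉTALE SCHEME ARE DETERMINED BY THEIR POINTS**: `I₁ = I₂` iff the same `k`-points of `G` lie on `V(I₁)` and `V(I₂)`.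
Together with ★ `HopfIdealOfFiniteSubgroupOfPoints` (a finite subgroup of points ↦ a Hopf ideal with exactly those points) and ★
`HopfIdealClosedSubgroup` §4 (the points killing a Hopf ideal form a subgroup) this is the dictionary «closed subgroup schemes of a finite
étale group over `k̄` = subgroups of `G(k)`», orders = degrees (above). [cite: StacksProject, Tag 00U3] [cite: Tate1997FiniteFlatGroupSchemes, (3.7)] -/
theorem eq_iff_forall_le_ker_ptEquiv_iff (I₁ I₂ : Ideal (Alg G)) :
    I₁ = I₂ ↔ ∀ x : specOver k k ⟶ G,
      (I₁ ≤ RingHom.ker (ptEquiv G k x).toRingHom ↔ I₂ ≤ RingHom.ker (ptEquiv G k x).toRingHom) := by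
  refine ⟨fun h x => by rw [h], fun h => ?_⟩
  haveI := algebraEtale_alg G
  haveI := etale_quotient_of_etale (k := k) I₁
  haveI := etale_quotient_of_etale (k := k) I₂
  ext a
  rw [EtaleIdealPoints.mem_iff_forall_algHom_apply_eq_zero (k := k) I₁ a,
    EtaleIdealPoints.mem_iff_forall_algHom_apply_eq_zero (k := k) I₂ a]
  refine ⟨fun H χ hχ => H χ ?_, fun H χ hχ => H χ ?_⟩
  · have := (h ((ptEquiv G k).symm χ)).2; simp only [Equiv.apply_symm_apply] at this; exact this hχ
  · have := (h ((ptEquiv G k).symm χ)).1; simp only [Equiv.apply_symm_apply] at this; exact this hχ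

/-- The inclusion-reversing form: `I₁ ≤ I₂` iff every point of `V(I₂)` is a point of `V(I₁)`. [cite: StacksProject, Tag 00U3] -/
theorem le_iff_forall_le_ker_ptEquiv (I₁ I₂ : Ideal (Alg G)) :
    I₁ ≤ I₂ ↔ ∀ x : specOver k k ⟶ G,
      I₂ ≤ RingHom.ker (ptEquiv G k x).toRingHom → I₁ ≤ RingHom.ker (ptEquiv G k x).toRingHom := by
  refine ⟨fun h x hx => h.trans hx, fun h a ha => ?_⟩
  haveI := algebraEtale_alg G
  haveI := etale_quotient_of_etale (k := k) I₂
  refine (EtaleIdealPoints.mem_iff_forall_algHom_apply_eq_zero (k := k) I₂ a).2 fun χ hχ => ?_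
  have := h ((ptEquiv G k).symm χ) (by simpa only [Equiv.apply_symm_apply] using hχ)
  simp only [Equiv.apply_symm_apply] at this
  exact this ha

end Scheme

end EtaleIdealPoints

end Literature.AlgebraicGeometry.GroupSchemes

end
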